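import Literature.Claims.NS.ClayPeriodicLerayHopfBridge
import Literature.Claims.NS.ClayR3LerayHopfBridge
import Literature.Analysis.FunctionSpaces.TorusHeatKernel
import Literature.Analysis.FunctionSpaces.TorusFourierSeries
import HarnessLib

/-!
# Claim skeleton (D-0090 NS-CLAIMS, C141, T3 QUICK row): Faliush 2026 — «Spectral Dissipation Barrier
# for the 3D Navier–Stokes Equations: Global Regularity via Gaussian-Weighted Littlewood–Paley Analysis»

**Cite header.** Dmytro I. Faliush, *Spectral Dissipation Barrier for the 3D Navier–Stokes Equations.
Global Regularity via Gaussian-Weighted Littlewood–Paley Analysis*, dated «January 22, 2026», Zenodo record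
18406805 (created 2026-01-28; PDF «Dissipation Barrier for the 3D Navier–Stokes Equations.pdf», 212835 B,
sha256[:16] `e3342a2670695f7f`, 4 pp.; PDF page = printed page) = OSF doi:10.17605/osf.io/edh39; bib key
`Faliush2026`. TEXT OF RECORD = the cell's census pin `run/shared/lean/pub/ns-claims/census/texts/Faliush2026/`
(README 5cbe92ad7137a449; `pages/p001–p004.txt`). UNREFEREED CLAIM under adjudication (cell `ns-claims`,
row C141, RULINGS v1.34 (3)) — NOTHING in this file asserts a step: every printed statement is a
`def … : Prop`; the only theorems are compositions by pure logic and the Clay (B) bridge.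
[cite: Faliush2026, abstract p.1; §4.1 Theorem 1 p.3; §6 p.4]

**Claimed statement (abstract p.1 l.7–17; §6 p.4 l.6; §7 p.4 l.8–9).** «We prove global regularity for the
three-dimensional incompressible Navier–Stokes equations on ℝ³ and 𝕋³ for arbitrary divergence-free initial
data u₀ ∈ L². … the solution remains in a fixed Gevrey class for all time, excluding finite-time blow-up by
contradiction.» §6: «Thus all Leray solutions become smooth and global.» §7: «The argument extends verbatim to
𝕋³ using periodic Littlewood–Paley theory.» Setting (1) p.2: `∂ₜu + (u·∇)u = νΔu − ∇p`, `∇·u = 0`, «on ℝ³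
or 𝕋³ with initial data u₀ ∈ L²», no force. Typed as `ClaimedTheorem := ClaimedTheoremR3 ∧ ClaimedTheoremT3`:
for every `ν > 0` and every divergence-free `L²` datum, EVERY global Leray–Hopf weak solution is, for `t > 0`,
a.e. equal to a classical solution on `(0, ∞)`.

**Clay delta (reference `ClayVariants.lean`).** Nearest Clay statements: (A) `clayR3.Regularity` (ℝ³) and (B)
`clayPeriodic.Regularity` (ℤ³-periodic). Δ1 domain = BOTH Clay domains (=). Δ3 force ≡ 0 (=). **Δ4 data class:
arbitrary divergence-free `u₀ ∈ L²` — WIDER than Fefferman's (4)/(8), so the claim is STRONGER than (A)/(B).**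
Δ5 solution class: smoothness for `t > 0` of every Leray–Hopf solution («all Leray solutions become smooth»),
plus «a fixed Gevrey class for all time» — with `L²` data nothing is claimed AT `t = 0` beyond `L²`; for a
SMOOTH datum the printed conclusion yields a classical bounded-energy / periodic solution from `t = 0` through
the tree's doors, so the 𝕋³ half IMPLIES (B): `clayB_of_claimedT3` (PROVED below, via Hopf existence +
weak–strong uniqueness + the Serrin `L^∞` door `ClayVariants.clayPeriodic_regularity_iff_lerayHopf_boundedFromLeft`);
the ℝ³ half implies (A) by the analogous door `Literature.Analysis.FluidPDE.clay_solution_of_locallyBounded_globalLerayHopf`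
+ `leray_existence_R3_holds` (recorded, not typed in rev 1). Δ6 form of conclusion (=, a theorem sentence).
Δ7 horizon `[0,∞)` (=). Viscosity: fixed `ν > 0` (=). NO «wrong problem» exit: the claim contains (A) and (B).

**RENDERING (typist's choices, recorded for the referee).**
(R1) The load-bearing displays (2)–(4), Theorem 1, Lemma 2, Proposition 1, Corollary 1 are statements about
the Gaussian-weighted functionals `‖e^{σΔ}f‖_{L²}`, `D̃_σ`, `G_σ`, `N_σ`; they are typed on the 𝕋³ instance (§7
«extends verbatim to 𝕋³»), SPECTRALLY: by Parseval on `𝕋³ = (ℝ/ℤ)³`, `‖e^{σΔ}f‖²_{L²} = Σ_k e^{−8π²σ|k|²}|f̂(k)|²`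
etc., with the tree's Fourier coefficients `mFourierCoeff (EuclideanSpace.complexify ∘ f) k` and heat symbol
`Torus.heatCoeff t k = e^{−4π²t|k|²}` — so that every display is a closed statement about explicit series and a
refutation can be a finite computation on trigonometric polynomials / single Fourier modes. The ℝ³ instances
are the same displays with Fourier integrals; they are not typed separately (the locator displays are common
to both settings).
(R2) `e^{σΔ}` IS THE HEAT SEMIGROUP, as printed (§2.3 «Gaussian weights ‖f‖_{L²_σ} := ‖e^{σΔ}f‖», §2.4
`D̃_σ(u) := ‖Δe^{σΔ/2}u‖²`, §4.2 «Heat-Kernel … Cancellation», «heat-kernel decay yields a factor 2^{−2j}»):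
symbol `e^{−4π²σ|k|²} ≤ 1`. The word «Gevrey» (abstract, §5) would suggest the GROWING weight `e^{σ|∇|}`
(Foias–Temam); that reading is NOT printed anywhere as a formula and is left to the referee's charitable
re-typing (under it Theorem 1 is still cubic-vs-quadratic). Consequence recorded, not used: as printed,
`G_σ(u) ≤ ‖u‖²_{L²}` for every field, so Corollary 1's «G_{σ₀}(t) is uniformly bounded» carries no regularity.
(R3) «smooth (divergence-free) solutions» = the tree's classical solutions of the unforced system on `𝕋³`,
`Torus.IsClassicalNSSolutionOn S ν 0 u p`, on closed slabs `S = [0, T]` (time derivatives within `S`);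
«Leray solutions» (§6) = `Torus.IsGlobalLerayHopf ν 0 u₀ u` / `FluidPDE.IsGlobalLerayHopf` on ℝ³.
(R4) Littlewood–Paley pieces `P_j` (§2.2, «dyadic partition {P_j}_{j∈ℤ}») are rendered by SHARP dyadic shells
`2^j ≤ |k| < 2^{j+1}`, `j ∈ ℕ` (on 𝕋³ nonzero frequencies have `|k| ≥ 1`; the zero mode carries no
`∇`/`Δ`), cell precedent `AbuGhuwaleh2026b.shellSet`; `N_{σ,j}` (Prop. 1, undefined in print) = the shell-`j`
part of the weighted pairing defining `N_σ`, so that `N_σ ≤ Σ_j N_{σ,j}` is the «Summing over j» of §4.4.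
(R5) Quantifiers (TYPING-HYGIENE 1/A1): constants printed without dependence («C», «C_ν», «c», «σ₀») are
existentially quantified AFTER `ν` (and after `σ` where the display carries `σ` free) and BEFORE the
solution/field; Theorem 1's `C_ν` is typed as an unconstrained real (weakest reading; Corollary 1 needs
`C_ν < 2ν`, which the print does not state — that need is isolated in the inference step `Step_Cor1_inf`).

**Step list (print locators; dependency order of the print).**
* `Step_L1a` — Lemma 1, first display, p.2 l.37–40: `d/dt G_σ(u) = −2ν D̃_σ(u) + 2⟨e^{σΔ}(u·∇u), e^{σΔ}u⟩`.
  Typist's flag: SUSPICIOUS as printed (the dissipation of `‖e^{σΔ}u‖²` is `2ν‖∇e^{σΔ}u‖²`, symbol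
  `4π²|k|²e^{−8π²σ|k|²}`, not `2ν‖Δe^{σΔ/2}u‖²`, symbol `16π⁴|k|⁴e^{−4π²σ|k|²}`; single-mode shear solutions
  decide it).
* `Step_L1b` — Lemma 1 (4) p.2 l.41–50: `‖Δu‖²_{L²} ≤ C(D̃_σ(u) + ‖u‖²_{L²})`. Flag: known-false pattern (one
  high Fourier mode: `16π⁴|k|⁴ ≤ C(16π⁴|k|⁴e^{−4π²σ|k|²} + 1)` fails for `|k|` large).
* `Step_L2` — Lemma 2 (Heat-Weighted Cancellation) p.3 l.15–21, `|l − j| ≤ 1`, «C independent of σ».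
* `Step_P1` — Proposition 1 p.3 l.35–43: `N_{σ,j} ≤ C 2^{−2j}‖Δu‖_{L²}‖P_ju‖²_{L²_σ}` «for each dyadic shell j».
* `Step_closure` — §4.4 p.3 l.44–45 «Summing over j and applying Young's inequality yields Theorem 1»: the
  implication `Step_P1 → Step_L1b → Step_Thm1` (typed as asserted; no argument printed).
* `Step_Thm1` — Theorem 1 (Spectral Dissipation Barrier) p.3 l.3–13: `∃ σ₀ > 0: N_{σ₀}(u) ≤ ½C_ν D̃_{σ₀}(u)`
  «for all smooth divergence-free solutions». PREDICTED LOCATOR (CARD §4, sealed 09:21:13Z): cubic vs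
  quadratic under `u ↦ λu`.
* `Step_Cor1_inf` — the word «Corollary» p.3 l.47: `Step_L1a → Step_Thm1 → Step_Cor1` (needs `C_ν < 2ν`, not
  printed).
* `Step_Cor1` — Corollary 1 p.3 l.47–51: for `σ = σ₀`, `d/dt G_{σ₀}(u) ≤ −c D̃_{σ₀}(u)`, «hence G_{σ₀}(t) is
  uniformly bounded».
* `Step_5` — §5 p.3 l.52–54 «Solutions enter a fixed Gevrey class instantly and remain there globally, implying
  bounds in all H^k»: `Step_Cor1 → AprioriHk` (as printed, from a bound on the SMOOTHING-weighted `G_{σ₀}`;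
  flag: non-sequitur under (R2)).
* `Step_6` — §6 p.4 l.1–6 «Exclusion of Blow-Up … By the Escauriaza–Seregin–Šverák criterion,
  ‖∇u‖_{L^∞_tL³_x} → ∞. However, Gevrey boundedness implies spectral control incompatible with this divergence.
  Contradiction. Thus all Leray solutions become smooth and global»: `AprioriHk → ClaimedTheoremT3`.
* §7 p.4 l.8–9 (torus case «verbatim») is the rendering (R1) itself; the ℝ³ half `ClaimedTheoremR3` is reached
  by the same chain read with Fourier integrals (not typed).

**COMPOSITION: proved as `claim_of_steps`** (pure logic: closure gives Theorem 1, «Corollary» gives Cor. 1,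
§5 gives the a priori `H^k` bounds, §6 gives the claim on 𝕋³); `clayB_of_steps` adds the Clay (B) bridge.

WHAT THIS IS NOT: not a claim about NS regularity or blow-up; not a claim about any author beyond the typed
locator.
-/

open scoped ContDiff ENNReal Topology RealInnerProductSpace
open _root_.MeasureTheory _root_.Set Function UnitAddTorus

namespace Literature.Claims.NS.Faliush2026

open Literature.Analysis.FunctionSpaces Literature.Analysis.FluidPDE Literature.Claims.NS.ClayVariants

noncomputable section

/-! ## Vocabulary (definitions with bodies; nothing asserted) -/

/-- The flat unit torus `𝕋³ = (ℝ/ℤ)³` (tree model). [cite: Faliush2026, (1) p.2 «on ℝ³ or 𝕋³»] -/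
abbrev T3 : Type := UnitAddTorus (Fin 3)

/-- Velocity values `ℝ³`. [cite: Faliush2026, (1) p.2] -/
abbrev E3 : Type := EuclideanSpace ℝ (Fin 3)

/-- The frequency lattice `ℤ³`. [cite: Faliush2026, §2.2 p.2] -/
abbrev Z3 : Type := Fin 3 → ℤ

/-- Fourier coefficient `v̂(k) ∈ ℂ³` of a field on `𝕋³` (tree convention: coefficients of the complexified
field). [cite: Faliush2026, §2.2 p.2] -/
def coeff (v : T3 → E3) (k : Z3) : EuclideanSpace ℂ (Fin 3) :=
  mFourierCoeff (EuclideanSpace.complexify ∘ v) k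

/-- The symbol `4π²|k|²` of `−Δ` at frequency `k`. [cite: Faliush2026, §2.3–2.4 p.2] -/
def lapSymb (k : Z3) : ℝ := 4 * Real.pi ^ 2 * Torus.freqNormSq k

/-- `‖f‖²_{L²_σ} = ‖e^{σΔ}f‖²_{L²}` (§2.3 p.2 «Gaussian Weights»), spectrally: `Σ_k e^{−8π²σ|k|²}|f̂(k)|²`
(heat symbol `Torus.heatCoeff (2σ) k = (e^{−4π²σ|k|²})²`). [cite: Faliush2026, §2.3 p.2] -/
def Gw (σ : ℝ) (v : T3 → E3) : ℝ :=
  ∑' k : Z3, Torus.heatCoeff (2 * σ) k * ‖coeff v k‖ ^ 2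

/-- (2) p.2, the «modified dissipation» `D̃_σ(u) := ‖Δ e^{σΔ/2} u‖²_{L²}`, spectrally
`Σ_k (4π²|k|²)² e^{−4π²σ|k|²} |û(k)|²`. [cite: Faliush2026, (2) p.2] -/
def Dw (σ : ℝ) (v : T3 → E3) : ℝ :=
  ∑' k : Z3, lapSymb k ^ 2 * Torus.heatCoeff σ k * ‖coeff v k‖ ^ 2

/-- The Gaussian-weighted `L²` pairing `⟨e^{σΔ}f, e^{σΔ}g⟩_{L²(𝕋³)}` of two real fields, spectrally
`Σ_k e^{−8π²σ|k|²} Re⟪f̂(k), ĝ(k)⟫_{ℂ³}`. [cite: Faliush2026, Lemma 1 p.2; Theorem 1 p.3] -/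
def pairW (σ : ℝ) (f g : T3 → E3) : ℝ :=
  ∑' k : Z3, Torus.heatCoeff (2 * σ) k * RCLike.re (inner ℂ (coeff f k) (coeff g k))

/-- Theorem 1's transfer functional `N_σ(u) := |⟨e^{σΔ}(u·∇u), e^{σΔ}u⟩|` (p.3 l.4–8), with
`u·∇u = Torus.convect u u`. [cite: Faliush2026, Theorem 1 p.3] -/
def Nw (σ : ℝ) (v : T3 → E3) : ℝ := |pairW σ (Torus.convect v v) v|

/-- `‖u‖²_{L²(𝕋³)}`. [cite: Faliush2026, (4) p.2] -/
def l2Sq (v : T3 → E3) : ℝ := ∫ x, ‖v x‖ ^ 2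

/-- `‖Δu‖²_{L²(𝕋³)}` (left side of (4) p.2; the factor `‖Δu‖_{L²}` of Lemma 2 / Prop. 1 p.3).
[cite: Faliush2026, (4) p.2] -/
def lapSq (v : T3 → E3) : ℝ := ∫ x, ‖Torus.laplacian v x‖ ^ 2

/-- Integer squared length `|k|²` of a lattice point. [cite: Faliush2026, §2.2 p.2] -/
def inormSq (k : Z3) : ℤ := ∑ i, k i ^ 2

/-- The SHARP dyadic shell `{k ∈ ℤ³ : 2^j ≤ |k| < 2^{j+1}}` (rendering (R4) of the Littlewood–Paley block
`P_j`, §2.2 p.2), as a finite set. [cite: Faliush2026, §2.2 p.2] -/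
def shell (j : ℕ) : Finset Z3 :=
  (Fintype.piFinset fun _ : Fin 3 => Finset.Icc (-(2 ^ (j + 1) : ℤ)) (2 ^ (j + 1))).filter
    fun k => (4 : ℤ) ^ j ≤ inormSq k ∧ inormSq k < (4 : ℤ) ^ (j + 1)

/-- The Littlewood–Paley piece `P_j v` as a FIELD (finite trigonometric sum over the shell; for smooth `v`
the full series `Σ_k Re(e_k(x) v̂(k))` converges to `v(x)`, tree `Torus.hasSum_realPart_mFourier_smul`).
[cite: Faliush2026, §2.2 p.2] -/
def shellPart (j : ℕ) (v : T3 → E3) (x : T3) : E3 :=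
  ∑ k ∈ shell j, EuclideanSpace.realPart (mFourier k x • coeff v k)

/-- `‖P_j v‖²_{L²_σ} = Σ_{k ∈ shell j} e^{−8π²σ|k|²}|v̂(k)|²` (Lemma 2 / Prop. 1 p.3). [cite: Faliush2026, Lemma 2 p.3] -/
def shellGw (σ : ℝ) (j : ℕ) (v : T3 → E3) : ℝ :=
  ∑ k ∈ shell j, Torus.heatCoeff (2 * σ) k * ‖coeff v k‖ ^ 2

/-- `‖P_j(e^{σΔ} w)‖_{L²}` for a field `w` (left side of Lemma 2 p.3 with `w = P_l u·∇P_j u`).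
[cite: Faliush2026, Lemma 2 p.3] -/
def shellHeatNorm (σ : ℝ) (j : ℕ) (w : T3 → E3) : ℝ :=
  Real.sqrt (∑ k ∈ shell j, Torus.heatCoeff (2 * σ) k * ‖coeff w k‖ ^ 2)

/-- `N_{σ,j}(u)`: the shell-`j` part of the weighted transfer pairing (rendering (R4) of Prop. 1's
undefined symbol, §4.3 p.3). [cite: Faliush2026, Proposition 1 p.3] -/
def Nshell (σ : ℝ) (j : ℕ) (v : T3 → E3) : ℝ :=
  |∑ k ∈ shell j, Torus.heatCoeff (2 * σ) k * RCLike.re (inner ℂ (coeff (Torus.convect v v) k) (coeff v k))|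

/-- The homogeneous `H^m` seminorm squared, spectrally `Σ_k |k|^{2m}|v̂(k)|²` («bounds in all H^k», §5 p.3).
[cite: Faliush2026, §5 p.3] -/
def hkSq (m : ℕ) (v : T3 → E3) : ℝ :=
  ∑' k : Z3, Torus.freqNormSq k ^ m * ‖coeff v k‖ ^ 2

/-! ## The claimed statements (nothing asserted) -/

/-- **CLAIM, 𝕋³ half** (abstract p.1; §6 p.4 l.6 «Thus all Leray solutions become smooth and global»; §7
p.4): for every `ν > 0`, every divergence-free `u₀ ∈ L²(𝕋³)` and EVERY global Leray–Hopf weak solution `u`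
of the unforced system from `u₀`, there is a classical solution `(U, P)` on `(0, ∞) × 𝕋³` with `u(t) = U(t)`
a.e. for every `t > 0`. [claim: Faliush2026, status: under-review] [cite: Faliush2026, abstract p.1; §6 p.4 l.6; §7 p.4 l.8–9] -/
def ClaimedTheoremT3 : Prop :=
  ∀ ν : ℝ, 0 < ν → ∀ u₀ : T3 → E3, MemLp u₀ 2 volume → Torus.IsWeaklyDivFree u₀ →
    ∀ u : ℝ → T3 → E3, Torus.IsGlobalLerayHopf ν 0 u₀ u →
      ∃ (U : ℝ → T3 → E3) (P : ℝ → T3 → ℝ),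
        Torus.IsClassicalNSSolutionOn (Ioi 0) ν 0 U P ∧ ∀ t : ℝ, 0 < t → U t =ᵐ[volume] u t

/-- **CLAIM, ℝ³ half** (abstract p.1; (1) p.2 «on ℝ³»; §6 p.4 l.6): the same on `ℝ³` with the tree's
whole-space Leray–Hopf and classical classes. [claim: Faliush2026, status: under-review] [cite: Faliush2026, abstract p.1; §6 p.4 l.6] -/
def ClaimedTheoremR3 : Prop :=
  ∀ ν : ℝ, 0 < ν → ∀ u₀ : E3 → E3, MemLp u₀ 2 volume → Literature.Analysis.FluidPDE.IsWeaklyDivFree u₀ →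
    ∀ u : ℝ → E3 → E3, Literature.Analysis.FluidPDE.IsGlobalLerayHopf ν 0 u₀ u →
      ∃ (U : ℝ → E3 → E3) (P : ℝ → E3 → ℝ),
        Literature.Analysis.FluidPDE.IsClassicalNSSolutionOn (Ioi 0) ν 0 U P ∧ ∀ t : ℝ, 0 < t → U t =ᵐ[volume] u t

/-- **CLAIMED THEOREM** (abstract p.1 «on ℝ³ and 𝕋³ for arbitrary divergence-free initial data u₀ ∈ L²»):
both halves. [claim: Faliush2026, status: under-review] [cite: Faliush2026, abstract p.1] -/
def ClaimedTheorem : Prop := ClaimedTheoremR3 ∧ ClaimedTheoremT3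

/-! ## The steps (nothing asserted) -/

/-- **Step L1a — Lemma 1, first display, p.2 l.37–40** «For smooth solutions,
`d/dt G_σ(u) = −2ν D̃_σ(u) + 2⟨e^{σΔ}(u·∇u), e^{σΔ}u⟩`»: along every classical unforced solution on a closed
slab `[0,T] × 𝕋³` and for every `σ > 0`, the time derivative (within `[0,T]`) of `t ↦ G_σ(u(t))` is the
printed right-hand side, with `D̃_σ` of (2). Typist's flag: suspicious as printed (dissipation symbol and the
sign of the transfer term; see (R2) and the step list). [claim: Faliush2026, status: under-review] [cite: Faliush2026, Lemma 1 p.2 l.37–40] -/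
def Step_L1a : Prop :=
  ∀ ν : ℝ, 0 < ν → ∀ T : ℝ, 0 < T → ∀ (u : ℝ → T3 → E3) (p : ℝ → T3 → ℝ),
    Torus.IsClassicalNSSolutionOn (Icc 0 T) ν 0 u p → ∀ σ : ℝ, 0 < σ → ∀ t ∈ Icc 0 T,
      HasDerivWithinAt (fun s => Gw σ (u s))
        (-2 * ν * Dw σ (u t) + 2 * pairW σ (Torus.convect (u t) (u t)) (u t)) (Icc 0 T) t

/-- **Step L1b — Lemma 1 (4), p.2 l.41–50** «Moreover, `‖Δu‖²_{L²} ≤ C(D̃_σ(u) + ‖u‖²_{L²})`», for smooth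
solutions; `C` printed bare — typed `∀ ν, σ > 0 ∃ C ∀` classical solutions `∀ t`. Typist's flag: known-false
pattern (one high Fourier mode). [claim: Faliush2026, status: under-review] [cite: Faliush2026, Lemma 1 (4) p.2 l.41–50] -/
def Step_L1b : Prop :=
  ∀ ν : ℝ, 0 < ν → ∀ σ : ℝ, 0 < σ → ∃ C : ℝ, ∀ T : ℝ, 0 < T → ∀ (u : ℝ → T3 → E3) (p : ℝ → T3 → ℝ),
    Torus.IsClassicalNSSolutionOn (Icc 0 T) ν 0 u p → ∀ t ∈ Icc 0 T,
      lapSq (u t) ≤ C * (Dw σ (u t) + l2Sq (u t))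

/-- **Step L2 — Lemma 2 (Heat-Weighted Cancellation), p.3 l.15–21** «Let `u ∈ H²`, `∇·u = 0`. For `|l−j| ≤ 1`,
`‖P_j(e^{σΔ}(P_l u·∇P_j u))‖_{L²} ≤ C 2^{−2j}‖Δu‖_{L²}‖P_j u‖_{L²_σ}`, with `C` independent of `σ`» — typed for
smooth divergence-free fields (narrower than `H²`; a refutation there refutes the printed class), `j, l ∈ ℕ`
(R4). (Printed proof: a commutator identity for `[e^{σΔ}, v·∇]` p.3 l.22–33; «the divergence-free condition
eliminates the principal term. Heat-kernel decay yields a factor 2^{−2j}».) [claim: Faliush2026, status: under-review] [cite: Faliush2026, Lemma 2 p.3 l.15–33] -/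
def Step_L2 : Prop :=
  ∃ C : ℝ, ∀ σ : ℝ, 0 < σ → ∀ v : T3 → E3, Torus.IsSmooth v → Torus.IsDivFree v →
    ∀ j l : ℕ, l ≤ j + 1 → j ≤ l + 1 →
      shellHeatNorm σ j (Torus.convect (shellPart l v) (shellPart j v)) ≤
        C * (2 : ℝ) ^ (-(2 * (j : ℝ))) * Real.sqrt (lapSq v) * Real.sqrt (shellGw σ j v)

/-- **Step P1 — Proposition 1 (triad analysis), p.3 l.35–43** «For each dyadic shell `j`,
`N_{σ,j} ≤ C 2^{−2j}‖Δu‖_{L²}‖P_j u‖²_{L²_σ}`. All six triad interactions … satisfy this bound» — typed for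
smooth divergence-free fields, `C` bare (before `σ`, after nothing: one constant), `N_{σ,j}` per (R4).
[claim: Faliush2026, status: under-review] [cite: Faliush2026, Proposition 1 p.3 l.35–43] -/
def Step_P1 : Prop :=
  ∃ C : ℝ, ∀ σ : ℝ, 0 < σ → ∀ v : T3 → E3, Torus.IsSmooth v → Torus.IsDivFree v → ∀ j : ℕ,
    Nshell σ j v ≤ C * (2 : ℝ) ^ (-(2 * (j : ℝ))) * Real.sqrt (lapSq v) * shellGw σ j v

/-- **Step Thm1 — Theorem 1 (Spectral Dissipation Barrier), p.3 l.3–13** «There exists `σ₀ > 0` such that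
`N_{σ₀}(u) := |⟨e^{σ₀Δ}(u·∇u), e^{σ₀Δ}u⟩| ≤ ½ C_ν D̃_{σ₀}(u)` for all smooth divergence-free solutions» —
`σ₀` and `C_ν` after `ν`, before the solution; `C_ν` an unconstrained real (R5). THE PREDICTED LOCATOR (CARD §4):
`N` is cubic and `D̃` quadratic under `u ↦ λu`. [claim: Faliush2026, status: under-review] [cite: Faliush2026, Theorem 1 p.3 l.3–13] -/
def Step_Thm1 : Prop :=
  ∀ ν : ℝ, 0 < ν → ∃ σ₀ : ℝ, 0 < σ₀ ∧ ∃ C : ℝ, ∀ T : ℝ, 0 < T → ∀ (u : ℝ → T3 → E3) (p : ℝ → T3 → ℝ),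
    Torus.IsClassicalNSSolutionOn (Icc 0 T) ν 0 u p → ∀ t ∈ Icc 0 T,
      Nw σ₀ (u t) ≤ (1 / 2 : ℝ) * C * Dw σ₀ (u t)

/-- **Step closure — §4.4 «Global Closure», p.3 l.44–45** «Summing over `j` and applying Young's inequality
yields Theorem 1»: typed as the implication the print asserts from Proposition 1 (and (4), which converts the
factor `‖Δu‖_{L²}` into `D̃`) to Theorem 1; no argument is printed. [claim: Faliush2026, status: under-review] [cite: Faliush2026, §4.4 p.3 l.44–45] -/
def Step_closure : Prop := Step_P1 → Step_L1b → Step_Thm1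

/-- **Step Cor1 — Corollary 1, p.3 l.47–51** «For `σ = σ₀`, `d/dt G_{σ₀}(u) ≤ −c D̃_{σ₀}(u)`, hence `G_{σ₀}(t)`
is uniformly bounded»: along every classical solution on `[0,T]`, the within-`[0,T]` derivative of
`t ↦ G_{σ₀}(u(t))` is `≤ −c D̃_{σ₀}(u(t))` for some `c > 0` (after `ν`), and `G_{σ₀}(u(t)) ≤ G_{σ₀}(u(0))`.
[claim: Faliush2026, status: under-review] [cite: Faliush2026, Corollary 1 p.3 l.47–51] -/
def Step_Cor1 : Prop :=
  ∀ ν : ℝ, 0 < ν → ∃ σ₀ : ℝ, 0 < σ₀ ∧ ∃ c : ℝ, 0 < c ∧ ∀ T : ℝ, 0 < T →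
    ∀ (u : ℝ → T3 → E3) (p : ℝ → T3 → ℝ), Torus.IsClassicalNSSolutionOn (Icc 0 T) ν 0 u p →
      ∀ t ∈ Icc 0 T,
        derivWithin (fun s => Gw σ₀ (u s)) (Icc 0 T) t ≤ -c * Dw σ₀ (u t) ∧ Gw σ₀ (u t) ≤ Gw σ₀ (u 0)

/-- **Step Cor1_inf — the word «Corollary», p.3 l.47** (implicit): Corollary 1 follows from Lemma 1's identity
and Theorem 1. (As typed this needs `C_ν < 2ν`, which the print does not state — R5.)
[claim: Faliush2026, status: under-review] [cite: Faliush2026, Corollary 1 p.3 l.47] -/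
def Step_Cor1_inf : Prop := Step_L1a → Step_Thm1 → Step_Cor1

/-- **A priori `H^k` bounds** — the content of §5 p.3 l.52–54 «Solutions enter a fixed Gevrey class instantly
and remain there globally, implying bounds in all `H^k`», at the grain §6 consumes (no blow-up of smooth
solutions): along every classical solution on a half-open slab `[0,T) × 𝕋³`, every `H^m` seminorm stays
bounded on `[0,T)`. (Equivalent in substance to Clay (B) for `m = 1`, cf.
`ClayVariants.clayPeriodic_regularity_iff_aprioriEnstrophyBound`.) [claim: Faliush2026, status: under-review] [cite: Faliush2026, §5 p.3 l.52–54] -/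
def AprioriHk : Prop :=
  ∀ ν : ℝ, 0 < ν → ∀ T : ℝ, 0 < T → ∀ (u : ℝ → T3 → E3) (p : ℝ → T3 → ℝ),
    Torus.IsClassicalNSSolutionOn (Ico 0 T) ν 0 u p → ∀ m : ℕ, ∃ M : ℝ, ∀ t ∈ Ico 0 T, hkSq m (u t) ≤ M

/-- **Step 5 — §5 p.3 l.52–54**, the inference from Corollary 1's bound on `G_{σ₀}` to «bounds in all H^k»,
typed as the implication the print asserts. Typist's flag: under (R2) a non-sequitur (`G_σ ≤ ‖u‖²_{L²}` is
bounded for every Leray–Hopf solution). [claim: Faliush2026, status: under-review] [cite: Faliush2026, §5 p.3 l.52–54] -/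
def Step_5 : Prop := Step_Cor1 → AprioriHk

/-- **Step 6 — §6 p.4 l.1–6** «Assume finite-time blow-up at `T < ∞`. By the Escauriaza–Seregin–Šverák
criterion, `‖∇u‖_{L^∞_tL³_x} → ∞`. However, Gevrey boundedness implies spectral control incompatible with this
divergence. Contradiction. Thus all Leray solutions become smooth and global»: typed as the implication from the
a priori bounds to the 𝕋³ claim (the ESS sentence cites the criterion for `∇u` in `L³`; recorded, not typed
separately). [claim: Faliush2026, status: under-review] [cite: Faliush2026, §6 p.4 l.1–6] -/
def Step_6 : Prop := AprioriHk → ClaimedTheoremT3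

/-! ## Kernel composition (pure logic; nothing asserted) -/

/-- **COMPOSITION (𝕋³ half)** — Lemma 1 (both displays), Lemma 2, Proposition 1, the §4.4 closure, the
«Corollary» inference, §5 and §6 give the claim on `𝕋³` exactly as the print chains them (Lemma 2 enters only
as the printed support of Proposition 1 and is carried as a hypothesis). [cite: Faliush2026, §§3–7 pp.2–4] -/
theorem claim_of_steps (_hL1a : Step_L1a) (_hL1b : Step_L1b) (_hL2 : Step_L2) (_hP1 : Step_P1)
    (hcl : Step_closure) (hinf : Step_Cor1_inf) (h5 : Step_5) (h6 : Step_6) : ClaimedTheoremT3 :=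
  h6 (h5 (hinf _hL1a (hcl _hP1 _hL1b)))

/-- The printed chain from Theorem 1 onward (the predicted locator as the first hypothesis).
[cite: Faliush2026, §§4–6 pp.3–4] -/
theorem claim_of_thm1 (hL1a : Step_L1a) (hThm1 : Step_Thm1) (hinf : Step_Cor1_inf) (h5 : Step_5)
    (h6 : Step_6) : ClaimedTheoremT3 :=
  h6 (h5 (hinf hL1a hThm1))

/-! ## Clay (B) bridge for the 𝕋³ half (PROVED: Δ4/Δ5 are «stronger than», not «other than») -/

/-- A smooth field on `𝕋³` is square-integrable (bounded on the compact torus). [folklore] -/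
private theorem memLp_two_of_isSmooth {U₀ : T3 → E3} (hs : Torus.IsSmooth U₀) : MemLp U₀ 2 volume := by
  have hc : Continuous U₀ := hs.continuous
  obtain ⟨B, hB⟩ := isCompact_univ.exists_bound_of_continuousOn hc.continuousOn
  exact MemLp.of_bound hc.aestronglyMeasurable B (ae_of_all _ fun y => hB y (mem_univ y))

/-- **The 𝕋³ half of the claim implies Clay (B)** (`clayPeriodic.Regularity`): for a smooth divergence-free
ℤ³-periodic datum `u₀`, every global Leray–Hopf solution on `𝕋³` from the descended datum is, by the claim,
a.e. equal for `t > 0` to a classical solution on `(0,∞)`, hence essentially bounded on `(T/2, T) × 𝕋³`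
below every `T > 0` (continuity on the compact `[T/2, T] × 𝕋³`); the tree's datum-wise Serrin `L^∞` door
`clayPeriodic_regularity_iff_lerayHopf_boundedFromLeft` (Hopf existence + weak–strong uniqueness + the
velocity blow-up alternative) turns this into printed-(10) solvability for every viscosity.
[cite: FeffermanClay2006, (B) with (8) (10) (11) p.2] [cite: RobinsonRodrigoSadowski2016, Thm 6.10, Thm 8.17] -/
theorem clayB_of_claimedT3 (h : ClaimedTheoremT3) : clayPeriodic.Regularity := by
  rw [clayPeriodic_regularity_iff_lerayHopf_boundedFromLeft]
  intro μ hμ u₀ hu₀ hdiv hper w hw T hT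
  -- the descended datum is smooth, divergence free, hence `L²` and weakly divergence free
  set U₀ : T3 → E3 := fun y => u₀ (Torus.repr y) with hU₀
  have hlift : Torus.lift U₀ = u₀ := Torus.lift_descend_holds u₀ hper
  have hs : Torus.IsSmooth U₀ := (contDiff_lift_iff_isSmooth U₀).1 (hlift ▸ hu₀)
  have hd : Torus.IsDivFree U₀ := (isDivFree_lift_iff_torus hs).1 (hlift ▸ hdiv)
  have hL2 : MemLp U₀ 2 volume := memLp_two_of_isSmooth hs
  have hwd : Torus.IsWeaklyDivFree U₀ :=
    Torus.IsDivFree.isWeaklyDivFree Torus.integral_inner_gradient_eq_neg_integral_mul_divergence_holds hs hd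
  obtain ⟨U, P, hUc, hagree⟩ := h μ hμ U₀ hL2 hwd w hw
  -- `U` is bounded on the compact slab `[T/2, T]`
  have hsub : Icc (T / 2) T ⊆ Ioi (0 : ℝ) := fun t ht => lt_of_lt_of_le (half_pos hT) ht.1
  obtain ⟨C, hC⟩ := hUc.smooth_velocity.exists_norm_le_of_isCompact isCompact_Icc hsub
  refine ⟨T / 2, half_lt_self hT, C, (ae_restrict_iff' measurableSet_Ioo).2 (ae_of_all _ fun t ht => ?_)⟩
  filter_upwards [hagree t ((half_pos hT).trans ht.1)] with y hy
  rw [← hy]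
  exact hC t ⟨ht.1.le, ht.2.le⟩ y

/-- With the steps, the 𝕋³ chain would settle Clay (B). [cite: Faliush2026, §7 p.4] [cite: FeffermanClay2006, (B) p.2] -/
theorem clayB_of_steps (hL1a : Step_L1a) (hL1b : Step_L1b) (hL2 : Step_L2) (hP1 : Step_P1)
    (hcl : Step_closure) (hinf : Step_Cor1_inf) (h5 : Step_5) (h6 : Step_6) :
    clayPeriodic.Regularity :=
  clayB_of_claimedT3 (claim_of_steps hL1a hL1b hL2 hP1 hcl hinf h5 h6)

/-! ## The ℝ³ half ⇒ Clay (A) (ns-claims-lit-4 g7, CLAY-LINK keeper, 2026-08-27; ADDITIVE — nothing above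
is touched): the door recorded in the module docstring («the ℝ³ half implies (A) by the analogous door …
recorded, not typed in rev 1») is typed here through the tree's
`ClayVariants.clayR3_regularity_iff_lerayHopf_locallyBounded` (`ClayR3LerayHopfBridge.lean`): a Clay datum
is `L²` and weakly divergence free, so `ClaimedTheoremR3` provides, for every global Leray–Hopf `v` from it,
a classical `(U, P)` on `(0, ∞)` with `U(t) = v(t)` a.e. for every `t > 0`; `U` is continuous on
`(0, ∞) × ℝ³`, hence bounded on the compact `[T/2, T] × B̄(x, 1)`, so `v` is essentially bounded on the
parabolic cylinder `Q_r(T, x)`, `r = min 1 √(T/2)` (slice-wise a.e. equality ⇒ product-a.e. by Fubini), which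
is the bridge's right-hand side. With `clayB_of_claimedT3` this gives `clay_of_claimed`. -/

section ClayR3Door

/-- Fubini localisation: a slice-wise a.e. bound on `I × B` for a product-a.e.-strongly-measurable
`uncurry v` is a product-a.e. bound. [folklore] -/
private theorem ae_prod_norm_le_of_forall_ae {Y F : Type*} [MeasureSpace Y] [SFinite (volume : Measure Y)]
    [NormedAddCommGroup F] {I : Set ℝ} {B : Set Y} {M : ℝ} {v : ℝ → Y → F} (hI : MeasurableSet I)
    (hvm : AEStronglyMeasurable (uncurry v) (volume.restrict (I ×ˢ B)))
    (h : ∀ t ∈ I, ∀ᵐ y ∂(volume.restrict B), ‖v t y‖ ≤ M) :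
    ∀ᵐ z ∂(volume.restrict (I ×ˢ B)), ‖uncurry v z‖ ≤ M := by
  have hprod : ((volume : Measure (ℝ × Y)).restrict (I ×ˢ B)) =
      ((volume : Measure ℝ).restrict I).prod ((volume : Measure Y).restrict B) := by
    rw [Measure.volume_eq_prod, Measure.prod_restrict]
  rw [hprod] at hvm ⊢
  set g := hvm.mk (uncurry v) with hg_def
  have hg : StronglyMeasurable g := hvm.stronglyMeasurable_mk
  have hvg : uncurry v =ᵐ[((volume : Measure ℝ).restrict I).prod ((volume : Measure Y).restrict B)] g :=
    hvm.ae_eq_mk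
  have hslice : ∀ᵐ t ∂((volume : Measure ℝ).restrict I), ∀ᵐ y ∂((volume : Measure Y).restrict B),
      uncurry v (t, y) = g (t, y) := Measure.ae_ae_of_ae_prod hvg
  have hset : MeasurableSet {z : ℝ × Y | ‖g z‖ ≤ M} :=
    measurableSet_le hg.norm.measurable measurable_const
  have hgM : ∀ᵐ z ∂((volume : Measure ℝ).restrict I).prod ((volume : Measure Y).restrict B),
      z ∈ {z : ℝ × Y | ‖g z‖ ≤ M} := by
    rw [Measure.ae_prod_mem_iff_ae_ae_mem hset]
    filter_upwards [hslice, ae_restrict_mem hI] with t ht htI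
    filter_upwards [ht, h t htI] with y hy hyM
    rw [← hy]
    exact hyM
  filter_upwards [hgM, hvg] with z hz hzg
  rw [hzg]
  exact hz

/-- **The ℝ³ half of the claim implies Clay (A)** (`clayR3.Regularity`): for a Clay datum `u₀` (smooth,
divergence free, rapidly decaying — so `L²` and weakly divergence free) every global Leray–Hopf weak
solution on `ℝ³` from `u₀` is, by the claim, a.e. equal for `t > 0` to a classical solution on `(0,∞)`, hence
essentially bounded on a parabolic cylinder below every point `(T, x)`, `T > 0` (continuity on the compact
`[T/2, T] × B̄(x, 1)`); the tree's datum-wise local Serrin `L^∞` door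
`ClayVariants.clayR3_regularity_iff_lerayHopf_locallyBounded` (Leray existence + weak–strong uniqueness +
Tao 2013 Lemma 8.1 / Cor. 11.1 + Prodi–Serrin) turns this into (A) at every viscosity.
[cite: Faliush2026, abstract p.1; §6 p.4 l.6] [cite: FeffermanClay2006, (A) with (4) (6) (7) p.2] -/
theorem clayA_of_claimedR3 (h : ClaimedTheoremR3) : clayR3.Regularity := by
  refine clayR3_regularity_iff_lerayHopf_locallyBounded.2 fun μ hμ u₀ hu₀ hdiv hdec v hv T hT x => ?_
  -- the datum is `L²` and weakly divergence free
  have hL2 : MemLp u₀ 2 volume := by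
    have hfin : ∫⁻ y, ‖u₀ y‖ₑ ^ 2 < ⊤ := by
      refine lt_of_le_of_lt (le_of_eq (lintegral_congr fun y => ?_))
        (hdec.lintegral_enorm_iteratedFDeriv_sq_lt_top (μ := volume) 0)
      rw [← ofReal_norm, ← ofReal_norm, norm_iteratedFDeriv_zero]
    exact ⟨hu₀.continuous.aestronglyMeasurable, eLpNorm_two_lt_top_of_lintegral_enorm_sq_lt_top hfin⟩
  have hwd : Literature.Analysis.FluidPDE.IsWeaklyDivFree u₀ :=
    VectorCalculus.IsDivFree.isWeaklyDivFree_holds (fun y => hdiv y) (hu₀.of_le (mod_cast le_top))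
  obtain ⟨U, P, hUc, hagree⟩ := h μ hμ u₀ hL2 hwd v hv
  -- the cylinder radius
  set r : ℝ := min 1 (Real.sqrt (T / 2)) with hr_def
  have hr0 : 0 < r := lt_min one_pos (Real.sqrt_pos.2 (by positivity))
  have hr1 : r ≤ 1 := min_le_left _ _
  have hr2 : r ^ 2 ≤ T / 2 := by
    calc r ^ 2 ≤ Real.sqrt (T / 2) ^ 2 := pow_le_pow_left₀ hr0.le (min_le_right _ _) 2
      _ = T / 2 := Real.sq_sqrt (by positivity)
  -- `U` is bounded on the compact `[T/2, T] × B̄(x, 1)`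
  have hK : IsCompact (Icc (T / 2) T ×ˢ Metric.closedBall x 1) :=
    isCompact_Icc.prod (isCompact_closedBall x 1)
  have hKsub : Icc (T / 2) T ×ˢ Metric.closedBall x 1 ⊆ Ioi (0 : ℝ) ×ˢ (univ : Set E3) :=
    prod_mono (fun t ht => lt_of_lt_of_le (half_pos hT) ht.1) (subset_univ _)
  have hcont : ContinuousOn (uncurry U) (Icc (T / 2) T ×ˢ Metric.closedBall x 1) :=
    (ContDiffOn.continuousOn hUc.smooth_velocity).mono hKsub
  obtain ⟨C, hC⟩ := hK.exists_bound_of_continuousOn hcont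
  -- the cylinder lies in the strip `(0, T) × ℝ³`, where `uncurry v` is a.e.-strongly measurable
  have hsub : Ioo (T - r ^ 2) T ×ˢ Metric.ball x r ⊆ Ioo 0 T ×ˢ (univ : Set E3) :=
    prod_mono (fun t ht => ⟨by linarith [ht.1, hr2], ht.2⟩) (subset_univ _)
  have hvm : AEStronglyMeasurable (uncurry v) (volume.restrict (Ioo (T - r ^ 2) T ×ˢ Metric.ball x r)) :=
    (hv T hT).weak.1.mono_measure (Measure.restrict_mono hsub le_rfl)
  -- slice-wise a.e. bound on the cylinder
  have hbd : ∀ t ∈ Ioo (T - r ^ 2) T, ∀ᵐ y ∂(volume.restrict (Metric.ball x r)), ‖v t y‖ ≤ C := by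
    intro t ht
    have ht0 : 0 < t := by linarith [ht.1, hr2]
    have htI : t ∈ Icc (T / 2) T := ⟨by linarith [ht.1, hr2], ht.2.le⟩
    refine (ae_restrict_iff' measurableSet_ball).2 ?_
    filter_upwards [hagree t ht0] with y hy hyB
    rw [← hy]
    have hy1 : y ∈ Metric.closedBall x 1 :=
      Metric.mem_closedBall.2 ((le_of_lt (Metric.mem_ball.1 hyB)).trans hr1)
    exact hC (t, y) ⟨htI, hy1⟩
  have hae := ae_prod_norm_le_of_forall_ae measurableSet_Ioo hvm hbd
  refine ⟨r, hr0, ?_⟩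
  rw [eLpNorm_exponent_top]
  exact eLpNormEssSup_lt_top_of_ae_bound (C := C) hae

/-- **Both halves of the claim imply the two Clay existence statements (A) and (B).**
[cite: Faliush2026, abstract p.1] [cite: FeffermanClay2006, (A), (B) p.2] -/
theorem clay_of_claimed (h : ClaimedTheorem) : clayR3.Regularity ∧ clayPeriodic.Regularity :=
  ⟨clayA_of_claimedR3 h.1, clayB_of_claimedT3 h.2⟩

end ClayR3Door

end

end Literature.Claims.NS.Faliush2026

-- WHAT THIS IS NOT: not a claim about NS regularity or blow-up; not a claim about any author beyond the typed locator.
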